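/-
Copyright: derived here (Resolution Observatory cell `pub-rosobs`, carver gen 57). AI-written Lean; AI review is weaker than expert
review.  The support bookkeeping behind engine 1's LEMMA LL Statement A — the identity `(ID_h)` of THEOREM-LT-eng1-g38 §2 (carver
target T58-A) — for the cell's POLYNOMIAL weighted-centre model `W(f)`: graded derivations shift weighted-homogeneous components.
Instrument — NOT a resolution theorem and NOT a statement about the invariant of [AbramovichTemkinWlodarczyk2024].
-/
import Mathlib.RingTheory.MvPolynomial.WeightedHomogeneous
import Mathlib.Algebra.MvPolynomial.Derivation
import Mathlib.Algebra.MvPolynomial.PDeriv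
import Mathlib.Data.Finsupp.Weight
import HarnessLib

/-!
# Graded derivations and weighted-homogeneous components: the layer identity behind `(ID_h)`

Uniform value line: INSTRUMENT — kernel-checked support bookkeeping for engine 1's LEMMA LL (THEOREM-LT-eng1-g38 §2, Statement A:
"the `C`-degree-`(d_h − 1)` component of `D(G_h)` receives exactly `∂_T P_h` and `Σ_β ε_C^β D(r_{h,β})`") in the cell's polynomial
weighted-centre model `W(f)`; NOT a resolution theorem, NOT a statement about the Abramovich–Temkin–Włodarczyk invariant, NOT summit
progress, and NOT a proof of LEMMA LL / LEMMA K / THEOREM LT themselves; AI-written Lean, AI review is weaker than expert review.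

## Content (notes ↔ this file)

Polynomial ring `MvPolynomial σ R`, a weight `w : σ → M` (`M` a cancellative commutative monoid), Mathlib's
`weightedHomogeneousComponent w m` ("`comp_m`") and `MvPolynomial.mkDerivation R f` = the derivation `Σ_i f_i ∂/∂X_i` with
`X_i ↦ f_i` (every derivation is of this form: `derivation_eq_mkDerivation`; the explicit sum `D f = Σ_i ∂_i f · D(X_i)` over a
`Fintype` is the tree's `WeightedBlowup.derivation_apply_eq_sum_pderiv_mul` (file `WeightedCentreConstantField`)).

* `IsGradedCoeff w ρ f`: every non-zero `f_i` is `w`-homogeneous of a degree `δ_i` with `δ_i + ρ = w_i` ("`Σ f_i ∂_i` is a graded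
  derivation of degree `−ρ`").  `isWeightedHomogeneous_mkDerivation_monomial`, **`weightedHomogeneousComponent_mkDerivation`**:
  `comp_m (D G) = D (comp_{m+ρ} G)` — a graded derivation of degree `−ρ` shifts components by `ρ`; `mkDerivation_component_eq_zero`.
* THE `C`-LAYER IDENTITY (`layer_identity`, `layer_identity_of_apply_eq_zero`): for a class `C ⊆ σ`, the `C`-degree `N` (`N_i = 1` on
  `C`, `0` off `C`) and a derivation `D` none of whose values `D(X_i)` involves a `C`-variable (`N`-degree `0`), split
  `D = D_C + D_L` (`D_C := Σ_{f ∈ C} D(X_f) ∂_f = ∂_T`, `D_L := Σ_{i ∉ C} D(X_i) ∂_i`; `mkDerivation_split`); then for every `G` and `k`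
  `comp_k (D G) = D_C (comp_{k+1} G) + D_L (comp_k G)`, and `D G = 0` gives `D_C (comp_{k+1} G) = − D_L (comp_k G)` — with `G := G_h`,
  `k := d_h − 1`, `comp_{d_h} G_h = P_h`, `comp_{d_h − 1} G_h = ℛ_h` this is `(ID_h)`: `∂_T P_h = − Σ_β ε_C^β D(r_{h,β})`
  (`D_L` acts on the light cofactors only).
* THE HEAVY DECOMPOSITION (`apply_component_eq_zero_of_degree_zero`, `apply_monomial_mul`, `apply_eq_zero_of_monomial_mul`): if every
  `D(X_i)` has degree `0` for a weight `v` and `D(X_y) = 0` whenever `v_y ≠ 0` (heavy slots are `D`-constant and no `D(X_i)` involves a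
  heavy variable — take `v` with values in `σ →₀ ℕ`, `v_y = e_y` on HEAVY, `0` elsewhere, so that `comp` sorts by the heavy part), then
  `D` preserves `v`-components, `D g = 0 ⇒ D(comp_h g) = 0`, and `D(X^h · G_h) = X^h · D(G_h)`, so `D(G_h) = 0` over a domain —
  the step "the decomposition by heavy part being unique, `D g = 0` gives `D(G_h) = 0`" of the notes.
  The graded lemmas assume only `[AddCommMonoid M] [IsCancelAdd M]`, so `M = ℕ`, `ℚ` and the heavy-exponent monoid `σ →₀ ℕ` all instantiate
  (the end-to-end assembly with `v` = heavy exponent is the companion module `WeightedCentreLemmaLLA`).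

References: [Lang2002] Ch. XIX §3 (derivations of polynomial rings: `D = Σ D(X_i) ∂/∂X_i`); context [AbramovichTemkinWlodarczyk2024]
§5 (weights, graded structure of a weighted centre).
-/

namespace Literature.AlgebraicGeometry.Resolution.WeightedBlowup

namespace DerivationLayers

open MvPolynomial

variable {σ R : Type*} [CommRing R]

/-! ## Every derivation of a polynomial ring is `Σ_i D(X_i) ∂_i` -/

/-- `D = mkDerivation (i ↦ D(X_i))`: a derivation of `R[X_σ]` is determined by its values on the variables ([Lang2002] Ch. XIX §3).
[cite: Lang2002, Ch. XIX §3] -/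
theorem derivation_eq_mkDerivation (D : Derivation R (MvPolynomial σ R) (MvPolynomial σ R)) :
    D = mkDerivation R (fun i => D (X i)) :=
  derivation_ext fun i => (mkDerivation_X R (fun j => D (X j)) i).symm

/-- Splitting a coefficient family along a predicate splits the derivation: `Σ_i f_i ∂_i = Σ_{p i} f_i ∂_i + Σ_{¬ p i} f_i ∂_i`
(`D = D_C + D_L` of LEMMA LL). [cite: Lang2002, Ch. XIX §3] -/
theorem mkDerivation_split (f : σ → MvPolynomial σ R) (p : σ → Prop) [DecidablePred p] :
    mkDerivation R f = mkDerivation R (fun i => if p i then f i else 0) + mkDerivation R (fun i => if p i then 0 else f i) := by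
  refine derivation_ext fun i => ?_
  rw [Derivation.add_apply, mkDerivation_X, mkDerivation_X, mkDerivation_X]
  split_ifs <;> simp

/-! ## Graded families and the component shift -/

section Graded

variable {M : Type*} [AddCommMonoid M]

/-- `f` is a GRADED FAMILY of degree `−ρ` for the weight `w`: every non-zero `f_i` is `w`-homogeneous of a degree `δ` with
`δ + ρ = w_i` (so `Σ_i f_i ∂_i` lowers `w`-degrees by `ρ`; the notes' "graded derivation of degree `−ρ`").
[cite: AbramovichTemkinWlodarczyk2024, §5] -/
def IsGradedCoeff (w : σ → M) (ρ : M) (f : σ → MvPolynomial σ R) : Prop :=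
  ∀ i, f i ≠ 0 → ∃ δ, IsWeightedHomogeneous w (f i) δ ∧ δ + ρ = w i

variable {w : σ → M} {ρ : M} {f : σ → MvPolynomial σ R}

/-- The weight of `e_i` is `w_i` (plumbing). [cite: AbramovichTemkinWlodarczyk2024, §5] -/
theorem weight_single_one (w : σ → M) (i : σ) : Finsupp.weight w (Finsupp.single i 1) = w i := by
  rw [Finsupp.weight_apply, Finsupp.sum_single_index (zero_smul ℕ (w i)), one_smul]

/-- One term of `D(X^s)`: `X^{s − e_i} · s_i · f_i` is homogeneous of a degree `d` with `d + ρ = weight s` (for `s_i ≠ 0`, `f_i ≠ 0`).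
[cite: AbramovichTemkinWlodarczyk2024, §5] -/
theorem term_isWeightedHomogeneous (hf : IsGradedCoeff w ρ f) {s : σ →₀ ℕ} {i : σ} (hi : s i ≠ 0) (hfi : f i ≠ 0) :
    ∃ d, IsWeightedHomogeneous w (monomial (s - Finsupp.single i 1) ((s i : ℕ) : R) * f i) d ∧ d + ρ = Finsupp.weight w s := by
  obtain ⟨δ, hδ, hδρ⟩ := hf i hfi
  refine ⟨Finsupp.weight w (s - Finsupp.single i 1) + δ, (isWeightedHomogeneous_monomial w _ _ rfl).mul hδ, ?_⟩
  rw [add_assoc, hδρ, ← weight_single_one w i, ← map_add, Finsupp.sub_add_single_one_cancel hi]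

/-- `D(r X^s)` is `w`-homogeneous of degree `m` whenever `m + ρ = weight s`, for `D = Σ f_i ∂_i` a graded family of degree `−ρ`.
[cite: AbramovichTemkinWlodarczyk2024, §5] -/
theorem isWeightedHomogeneous_mkDerivation_monomial [IsCancelAdd M] (hf : IsGradedCoeff w ρ f) (s : σ →₀ ℕ) (r : R) {m : M}
    (hm : m + ρ = Finsupp.weight w s) : IsWeightedHomogeneous w (mkDerivation R f (monomial s r)) m := by
  rw [mkDerivation_monomial, Finsupp.sum, MvPolynomial.smul_eq_C_mul]
  refine (IsWeightedHomogeneous.sum _ _ m fun i hi => ?_).C_mul r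
  rw [smul_eq_mul]
  by_cases hfi : f i = 0
  · rw [hfi, mul_zero]; exact isWeightedHomogeneous_zero R w m
  · obtain ⟨d, hd, hdρ⟩ := term_isWeightedHomogeneous hf (Finsupp.mem_support_iff.mp hi) hfi
    rwa [add_right_cancel (hdρ.trans hm.symm)] at hd

/-- **Component shift**: `comp_m (D G) = D (comp_{m+ρ} G)` for `D = Σ f_i ∂_i` a graded family of degree `−ρ` — a graded derivation
of degree `−ρ` carries the component of degree `m + ρ` onto the component of degree `m` (the mechanism behind "`D` acts on a
`C`-variable — lowering the `C`-degree by one — or on a light variable — keeping it" of the notes). [cite: AbramovichTemkinWlodarczyk2024, §5] -/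
theorem weightedHomogeneousComponent_mkDerivation [IsCancelAdd M] (hf : IsGradedCoeff w ρ f) (G : MvPolynomial σ R) (m : M) :
    weightedHomogeneousComponent w m (mkDerivation R f G) = mkDerivation R f (weightedHomogeneousComponent w (m + ρ) G) := by
  classical
  induction G using MvPolynomial.induction_on' with
  | add p q hp hq => simp only [map_add, hp, hq]
  | monomial s r =>
    have hmono := isWeightedHomogeneous_monomial w s r (rfl : Finsupp.weight w s = Finsupp.weight w s)
    by_cases hs : Finsupp.weight w s = m + ρ
    · rw [← hs, hmono.weightedHomogeneousComponent_same,
        (isWeightedHomogeneous_mkDerivation_monomial hf s r hs.symm).weightedHomogeneousComponent_same]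
    · rw [hmono.weightedHomogeneousComponent_ne (m + ρ) (Ne.symm hs), map_zero, mkDerivation_monomial, Finsupp.sum,
        Finset.smul_sum, map_sum]
      refine Finset.sum_eq_zero fun i hi => ?_
      rw [smul_eq_mul, MvPolynomial.smul_eq_C_mul, weightedHomogeneousComponent_C_mul]
      by_cases hfi : f i = 0
      · rw [hfi, mul_zero, map_zero, mul_zero]
      · obtain ⟨d, hd, hdρ⟩ := term_isWeightedHomogeneous hf (Finsupp.mem_support_iff.mp hi) hfi
        rw [hd.weightedHomogeneousComponent_ne m (fun hmd => hs (by rw [← hdρ, hmd])), mul_zero]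

/-- If `D G = 0` for a graded `D = Σ f_i ∂_i` of degree `−ρ`, then `D (comp_{m+ρ} G) = 0` for every `m`. [cite: AbramovichTemkinWlodarczyk2024, §5] -/
theorem mkDerivation_component_eq_zero [IsCancelAdd M] (hf : IsGradedCoeff w ρ f) {G : MvPolynomial σ R} (hG : mkDerivation R f G = 0)
    (m : M) : mkDerivation R f (weightedHomogeneousComponent w (m + ρ) G) = 0 := by
  rw [← weightedHomogeneousComponent_mkDerivation hf G m, hG, map_zero]

end Graded

/-! ## The `C`-layer identity (LEMMA LL, Statement A) -/

section Layer

variable (C : Set σ) [DecidablePred (· ∈ C)] {N : σ → ℕ}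

/-- The `C`-part `D_C = Σ_{f ∈ C} D(X_f) ∂_f` (`= ∂_T` with `T_f := D(X_f)`) of a family none of whose members involves a `C`-variable is
graded of degree `−1` for the `C`-degree `N` (`N = 1` on `C`, `0` off `C`). [cite: AbramovichTemkinWlodarczyk2024, §5] -/
theorem isGradedCoeff_C_part (hNC : ∀ i ∈ C, N i = 1) (f : σ → MvPolynomial σ R) (hf : ∀ i, IsWeightedHomogeneous N (f i) 0) :
    IsGradedCoeff N 1 (fun i => if i ∈ C then f i else 0) := by
  intro i hi
  by_cases hiC : i ∈ C
  · exact ⟨0, by simpa [hiC] using hf i, by rw [zero_add, hNC i hiC]⟩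
  · exact absurd (if_neg hiC) hi

/-- The light part `D_L = Σ_{i ∉ C} D(X_i) ∂_i` of such a family is graded of degree `0` for `N`. [cite: AbramovichTemkinWlodarczyk2024, §5] -/
theorem isGradedCoeff_L_part (hNL : ∀ i ∉ C, N i = 0) (f : σ → MvPolynomial σ R) (hf : ∀ i, IsWeightedHomogeneous N (f i) 0) :
    IsGradedCoeff N 0 (fun i => if i ∈ C then 0 else f i) := by
  intro i hi
  by_cases hiC : i ∈ C
  · exact absurd (if_pos hiC) hi
  · exact ⟨0, by simpa [hiC] using hf i, by rw [zero_add, hNL i hiC]⟩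

/-- **The `C`-layer identity** (LEMMA LL Statement A, THEOREM-LT §2): if no `D(X_i)` involves a `C`-variable then for every `G` and
every `C`-degree `k`:  `comp_k (D G) = D_C (comp_{k+1} G) + D_L (comp_k G)`  with `D_C = Σ_{f∈C} D(X_f) ∂_f`, `D_L = Σ_{i∉C} D(X_i) ∂_i`.
[cite: AbramovichTemkinWlodarczyk2024, §5] -/
theorem layer_identity (hNC : ∀ i ∈ C, N i = 1) (hNL : ∀ i ∉ C, N i = 0)
    (D : Derivation R (MvPolynomial σ R) (MvPolynomial σ R)) (hD : ∀ i, IsWeightedHomogeneous N (D (X i)) 0)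
    (G : MvPolynomial σ R) (k : ℕ) :
    weightedHomogeneousComponent N k (D G) =
      mkDerivation R (fun i => if i ∈ C then D (X i) else 0) (weightedHomogeneousComponent N (k + 1) G) +
      mkDerivation R (fun i => if i ∈ C then 0 else D (X i)) (weightedHomogeneousComponent N k G) := by
  have hsplit := mkDerivation_split (R := R) (fun i => D (X i)) (· ∈ C)
  conv_lhs => rw [derivation_eq_mkDerivation D, hsplit, Derivation.add_apply, map_add]
  rw [weightedHomogeneousComponent_mkDerivation (isGradedCoeff_C_part C hNC _ hD),
    weightedHomogeneousComponent_mkDerivation (isGradedCoeff_L_part C hNL _ hD), add_zero]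

/-- **`(ID_h)`**: if moreover `D G = 0` then `D_C (comp_{k+1} G) = − D_L (comp_k G)` for every `k` — with `G = G_h`, `k = d_h − 1`:
`∂_T P_h = − Σ_β ε_C^β · D(r_{h,β})` (THEOREM-LT §2). [cite: AbramovichTemkinWlodarczyk2024, §5] -/
theorem layer_identity_of_apply_eq_zero (hNC : ∀ i ∈ C, N i = 1) (hNL : ∀ i ∉ C, N i = 0)
    (D : Derivation R (MvPolynomial σ R) (MvPolynomial σ R)) (hD : ∀ i, IsWeightedHomogeneous N (D (X i)) 0)
    {G : MvPolynomial σ R} (hG : D G = 0) (k : ℕ) :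
    mkDerivation R (fun i => if i ∈ C then D (X i) else 0) (weightedHomogeneousComponent N (k + 1) G) =
      - mkDerivation R (fun i => if i ∈ C then 0 else D (X i)) (weightedHomogeneousComponent N k G) := by
  have h := layer_identity C hNC hNL D hD G k
  rw [hG, map_zero] at h
  exact eq_neg_of_add_eq_zero_left h.symm

/-- The `C`-part is `∂_T`: on the variables, `D_C (X_f) = D(X_f)` for `f ∈ C` and `D_C (X_i) = 0` otherwise (this characterises `D_C`,
`derivation_ext`). [cite: Lang2002, Ch. XIX §3] -/
theorem C_part_X (D : Derivation R (MvPolynomial σ R) (MvPolynomial σ R)) (i : σ) :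
    mkDerivation R (fun j => if j ∈ C then D (X j) else 0) (X i) = if i ∈ C then D (X i) else 0 :=
  mkDerivation_X R (fun j => if j ∈ C then D (X j) else 0) i

end Layer

/-! ## The heavy decomposition: `D g = 0 ⇒ D(G_h) = 0` -/

section Heavy

variable {M : Type*} [AddCommMonoid M] [IsCancelAdd M] {v : σ → M}

/-- If every `D(X_i)` has `v`-degree `0` and `D(X_y) = 0` whenever `v_y ≠ 0`, then `D` preserves `v`-components:
`comp_m (D G) = D (comp_m G)` (take `v` = the heavy exponent: heavy slots `D`-constant, no heavy variable in any `D(X_i)`).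
[cite: AbramovichTemkinWlodarczyk2024, §5] -/
theorem weightedHomogeneousComponent_apply_of_degree_zero (D : Derivation R (MvPolynomial σ R) (MvPolynomial σ R))
    (hD : ∀ i, IsWeightedHomogeneous v (D (X i)) 0) (hH : ∀ i, v i ≠ 0 → D (X i) = 0) (G : MvPolynomial σ R) (m : M) :
    weightedHomogeneousComponent v m (D G) = D (weightedHomogeneousComponent v m G) := by
  have hf : IsGradedCoeff v 0 (fun i => D (X i)) := fun i hi =>
    ⟨0, hD i, by rw [zero_add]; by_contra h0; exact hi (hH i (Ne.symm h0))⟩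
  have h := weightedHomogeneousComponent_mkDerivation hf G m
  rwa [add_zero, ← derivation_eq_mkDerivation D] at h

/-- Hence `D g = 0` forces `D (comp_h g) = 0` for every heavy part `h` ("the decomposition by heavy part being unique").
[cite: AbramovichTemkinWlodarczyk2024, §5] -/
theorem apply_component_eq_zero_of_degree_zero (D : Derivation R (MvPolynomial σ R) (MvPolynomial σ R))
    (hD : ∀ i, IsWeightedHomogeneous v (D (X i)) 0) (hH : ∀ i, v i ≠ 0 → D (X i) = 0) {G : MvPolynomial σ R} (hG : D G = 0)
    (m : M) : D (weightedHomogeneousComponent v m G) = 0 := by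
  rw [← weightedHomogeneousComponent_apply_of_degree_zero D hD hH G m, hG, map_zero]

/-- A monomial in `D`-constant variables is `D`-constant: `D(X^h) = 0` if `D(X_y) = 0` for every `y` occurring in `h`.
[cite: Lang2002, Ch. XIX §3] -/
theorem apply_monomial_eq_zero (D : Derivation R (MvPolynomial σ R) (MvPolynomial σ R)) {h : σ →₀ ℕ}
    (hh : ∀ y ∈ h.support, D (X y) = 0) (r : R) : D (monomial h r) = 0 := by
  rw [derivation_eq_mkDerivation D, mkDerivation_monomial, Finsupp.sum]
  refine smul_eq_zero_of_right r (Finset.sum_eq_zero fun y hy => ?_)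
  rw [hh y hy, smul_zero]

/-- `D(X^h · Q) = X^h · D(Q)` for `X^h` a monomial in `D`-constant variables (Leibniz). [cite: Lang2002, Ch. XIX §3] -/
theorem apply_monomial_mul (D : Derivation R (MvPolynomial σ R) (MvPolynomial σ R)) {h : σ →₀ ℕ}
    (hh : ∀ y ∈ h.support, D (X y) = 0) (r : R) (Q : MvPolynomial σ R) :
    D (monomial h r * Q) = monomial h r * D Q := by
  rw [Derivation.leibniz, apply_monomial_eq_zero D hh r, smul_zero, add_zero, smul_eq_mul]

/-- Over a domain: `D(X^h · G_h) = 0` with `X^h` in `D`-constant variables (`r ≠ 0`) forces `D(G_h) = 0` — the conclusion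
"`D(G_h) = 0` for every `h`" of LEMMA LL's proof. [cite: Lang2002, Ch. XIX §3] -/
theorem apply_eq_zero_of_monomial_mul [IsDomain R] (D : Derivation R (MvPolynomial σ R) (MvPolynomial σ R)) {h : σ →₀ ℕ}
    (hh : ∀ y ∈ h.support, D (X y) = 0) {r : R} (hr : r ≠ 0) {Q : MvPolynomial σ R} (hQ : D (monomial h r * Q) = 0) :
    D Q = 0 := by
  rw [apply_monomial_mul D hh r Q] at hQ
  exact (mul_eq_zero.mp hQ).resolve_left (monomial_eq_zero.not.mpr hr)

end Heavy

end DerivationLayers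

end Literature.AlgebraicGeometry.Resolution.WeightedBlowup
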